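import Literature.NumberTheory.EllipticCurves.IwasawaAlgebraLiftingExponentProofs
import Mathlib.RingTheory.PowerSeries.WeierstrassPreparation
import HarnessLib

/-!
# Input (R1) of both all-rank roads to item 23110 (`(H⁺)^∨ ≅ Λ` at `2`, Kim 2007 Prop. 3.17), pure-algebra brick: a CYCLIC
# `Λ = ℤ_p⟦T⟧`-module whose layer coinvariants `X/ω_n X` have UNBOUNDED `ℤ_p`-rank is free of rank one — and
# `rank_{ℤ_p} Λ/(f) < ∞` for every `f ≠ 0` (Weierstrass preparation)

Routes `ResidualThetaTransportAtTwo` (RTT, crux r201 `ResidualLambdaFormulaNegDiscAtTwo`, stmt-BirchSwinnertonDyer-23110) /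
`ThetaPartnerAtTwo`. Seat `prover-bsd-wall-tp2-p2x-w2` g14; `--supports stmt-BirchSwinnertonDyer-23110`. THEOREMS ONLY, PURE ALGEBRA
(no definition, no named fact, no `sorry`); nothing about any curve is asserted.

WHY. The lead's programme (memo RLF-TWIST-ROAD-g12 §3, item (R1), shared by road T and road Λ): the Pontryagin dual of
`H⁺ = E⁺_∞ ⊗ ℚ₂/ℤ₂` is `Λ`-cyclic (K4: CYC⁺, `plusCyclic_of_honda`) and its layer coinvariants have unbounded `ℤ₂`-rank (rank growth of
`E⁺(ℚ_{n,2})`); «cyclic + unbounded ⇒ free of rank 1» is the algebra proved HERE, for an abstract `Λ`-module: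

* `moduleFinite_quotient_span_of_not_dvd_coeff` — `Λ/(g)` is a finitely generated `ℤ_p`-module when some coefficient of `g` is a
  unit (Weierstrass preparation, Mathlib `PowerSeries.exists_isWeierstrassFactorization` + `IsWeierstrassFactorizationAt.algEquivQuotient`
  + `Polynomial.Monic.finite_quotient`);
* `rank_quotient_span_lt_aleph0` — `rank_{ℤ_p} Λ/(f) < ℵ₀` for EVERY `f ≠ 0`: `f = p^m g` (`exists_eq_pow_mul_of_ne_zero`), the
  multiplication by `p^m` on `Λ/(f)` has `p^m`-torsion kernel (rank `0`) and image inside a quotient of `Λ/(g)` (rank–nullity over `ℤ_p`);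
* `nonempty_linearEquiv_of_span_singleton_eq_top_of_unbounded` — if `X = Λ x` and the `ℤ_p`-ranks of `X ⧸ ω_n X`,
  `ω_n = (1+T)^{p^n} − 1`, are unbounded, then `X ≃ₗ[Λ] Λ`: otherwise `0 ≠ f ∈ ann(x)` and every `X ⧸ ω_n X` is a quotient of `Λ/(f)`.

HONEST FRAMING: closes nothing; the cohomological inputs of (R1) (cyclicity of `(H⁺)^∨`, rank growth) are NOT addressed here;
23110 is NOT proved; BSD is not proved by any of this.
References: [Washington1997] Thm. 7.3 (Weierstrass preparation), §13.2; [BDKim2007] B. D. Kim, Compositio Math. 143 (2007) Prop. 3.17;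
[NeukirchSchmidtWingberg2008] Ch. V §3.
-/

set_option autoImplicit false
-- D-0017: single-problem summit, so `Summit.BirchSwinnertonDyer.BirchSwinnertonDyer.…` repeats a namespace BY DESIGN.
set_option linter.dupNamespace false

noncomputable section

open Polynomial
open Literature.NumberTheory.EllipticCurves

namespace Summit.BirchSwinnertonDyer.BirchSwinnertonDyer.Theorems.ResidualThetaLayer.CyclicLambda

variable (p : ℕ) [Fact p.Prime]

/-- **`Λ/(g)` is `ℤ_p`-finite when `g` has a unit coefficient** (Weierstrass preparation: `g = f·h`, `f` distinguished, `h` a unit, so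
`Λ/(g) = Λ/(f) ≅ ℤ_p[X]/(f)` is finite free). [cite: Washington1997, Thm. 7.3 and Prop. 7.2] -/
theorem moduleFinite_quotient_span_of_not_dvd_coeff (g : IwasawaAlgebra p) (i : ℕ)
    (hg : ¬ (p : ℤ_[p]) ∣ PowerSeries.coeff i g) :
    Module.Finite ℤ_[p] (IwasawaAlgebra p ⧸ Ideal.span {g}) := by
  have hres : g.map (IsLocalRing.residue ℤ_[p]) ≠ 0 := by
    intro h
    have hi := congrArg (PowerSeries.coeff i) h
    rw [PowerSeries.coeff_map, map_zero, IsLocalRing.residue_eq_zero_iff, PadicInt.maximalIdeal_eq_span_p,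
      Ideal.mem_span_singleton] at hi
    exact hg hi
  obtain ⟨f, h, H⟩ := PowerSeries.exists_isWeierstrassFactorization hres
  haveI := H.isDistinguishedAt.monic.finite_quotient
  exact Module.Finite.equiv H.algEquivQuotient.toLinearEquiv

/-- **`rank_{ℤ_p} Λ/(f) < ℵ₀` for every non-zero `f ∈ Λ`.** Write `f = p^m g` with a unit coefficient in `g`; on `Λ/(f)` the
multiplication by `p^m` has kernel killed by `p^m` (rank `0`) and image contained in the image of `Λ/(g) → Λ/(f)`, `[z] ↦ [p^m z]`,
which has rank `≤ rank Λ/(g) < ℵ₀`; rank–nullity over `ℤ_p`. [cite: Washington1997, §7.1 (proof of Thm. 7.3) and §13.2] -/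
theorem rank_quotient_span_lt_aleph0 {f : IwasawaAlgebra p} (hf : f ≠ 0) :
    Module.rank ℤ_[p] (IwasawaAlgebra p ⧸ Ideal.span {f}) < Cardinal.aleph0 := by
  classical
  obtain ⟨m, g, hfg, i, hi⟩ := IwasawaAlgebra.exists_eq_pow_mul_of_ne_zero p hf
  haveI := moduleFinite_quotient_span_of_not_dvd_coeff p g i hi
  set M := IwasawaAlgebra p ⧸ Ideal.span {f} with hM
  -- multiplication by `p^m` (a `Λ`-linear endomorphism of `M`)
  let μ : M →ₗ[IwasawaAlgebra p] M := ((p : IwasawaAlgebra p) ^ m) • LinearMap.id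
  have hμ : ∀ y : M, μ y = ((p : IwasawaAlgebra p) ^ m) • y := fun y ↦ rfl
  -- `[z] ↦ [p^m z]` from `Λ/(g)`
  let ν₀ : IwasawaAlgebra p →ₗ[IwasawaAlgebra p] M :=
    (Submodule.mkQ (Ideal.span {f})) ∘ₗ (((p : IwasawaAlgebra p) ^ m) • LinearMap.id)
  have hν₀ : ∀ z : IwasawaAlgebra p, ν₀ z = Submodule.Quotient.mk (((p : IwasawaAlgebra p) ^ m) * z) := fun z ↦ rfl
  have hker : Ideal.span {g} ≤ LinearMap.ker ν₀ := by
    intro z hz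
    obtain ⟨c, rfl⟩ := Ideal.mem_span_singleton'.mp hz
    rw [LinearMap.mem_ker, hν₀, Submodule.Quotient.mk_eq_zero]
    refine Ideal.mem_span_singleton'.mpr ⟨c, ?_⟩
    rw [hfg]; ring
  let ν : (IwasawaAlgebra p ⧸ Ideal.span {g}) →ₗ[IwasawaAlgebra p] M := (Ideal.span {g}).liftQ ν₀ hker
  -- `range μ ≤ range ν`
  have hrange : LinearMap.range (μ.restrictScalars ℤ_[p]) ≤ LinearMap.range (ν.restrictScalars ℤ_[p]) := by
    rintro _ ⟨y, rfl⟩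
    obtain ⟨z, rfl⟩ := Submodule.Quotient.mk_surjective (Ideal.span {f}) y
    refine ⟨Submodule.Quotient.mk z, ?_⟩
    rw [LinearMap.restrictScalars_apply, LinearMap.restrictScalars_apply, hμ]
    change ν₀ z = _
    rw [hν₀, ← smul_eq_mul, Submodule.Quotient.mk_smul]
  have hrank_range : Module.rank ℤ_[p] (LinearMap.range (μ.restrictScalars ℤ_[p])) < Cardinal.aleph0 :=
    calc Module.rank ℤ_[p] (LinearMap.range (μ.restrictScalars ℤ_[p]))
        ≤ Module.rank ℤ_[p] (LinearMap.range (ν.restrictScalars ℤ_[p])) := Submodule.rank_mono hrange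
      _ ≤ Module.rank ℤ_[p] (IwasawaAlgebra p ⧸ Ideal.span {g}) :=
          LinearMap.rank_le_of_surjective _ (LinearMap.surjective_rangeRestrict _)
      _ < Cardinal.aleph0 := Module.rank_lt_aleph0 ℤ_[p] _
  -- `ker μ` is `p^m`-torsion, of rank `0`
  have hrank_ker : Module.rank ℤ_[p] (LinearMap.ker (μ.restrictScalars ℤ_[p])) = 0 := by
    rw [rank_eq_zero_iff]
    intro y
    refine ⟨(p : ℤ_[p]) ^ m, pow_ne_zero _ (by exact_mod_cast (Fact.out : p.Prime).ne_zero), Subtype.ext ?_⟩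
    have hy : μ (y : M) = 0 := y.2
    rw [hμ] at hy
    rw [SetLike.val_smul, ZeroMemClass.coe_zero, ← hy, ← map_natCast (algebraMap ℤ_[p] (IwasawaAlgebra p)), ← map_pow,
      algebraMap_smul]
  have hrn := LinearMap.rank_range_add_rank_ker (μ.restrictScalars ℤ_[p])
  rw [hrank_ker, add_zero] at hrn
  rw [← hrn]
  exact hrank_range

variable {Y : Type} [AddCommGroup Y] [Module (IwasawaAlgebra p) Y] [Module ℤ_[p] Y]
  [IsScalarTower ℤ_[p] (IwasawaAlgebra p) Y]

/-- **A cyclic `Λ`-module with unbounded layer ranks is free of rank one.** Let `X = Λ·x` be a cyclic `Λ = ℤ_p⟦T⟧`-module such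
that the `ℤ_p`-ranks of the layer coinvariants `X ⧸ ω_n X`, `ω_n = (1+T)^{p^n} − 1`, are unbounded. Then `X ≃ₗ[Λ] Λ`: the
annihilator of `x` is `0`, for a non-zero `f` in it would make every `X ⧸ ω_n X` a quotient of `Λ/(f)`, of `ℤ_p`-rank bounded by
`rank Λ/(f) < ∞` (`rank_quotient_span_lt_aleph0`). (For `(H⁺)^∨` at `2`: cyclic by CYC⁺, unbounded by the growth of
`rank E⁺(ℚ_{n,2})` — Kim 2007 Prop. 3.17.) [cite: BDKim2007, Prop. 3.17] [cite: Washington1997, §13.2] -/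
theorem nonempty_linearEquiv_of_span_singleton_eq_top_of_unbounded (x : Y)
    (hx : Submodule.span (IwasawaAlgebra p) {x} = ⊤)
    (hunb : ∀ B : ℕ, ∃ n : ℕ, (B : Cardinal) < Module.rank ℤ_[p]
      (Y ⧸ (Ideal.span {(((X + 1 : ℤ_[p][X]) ^ p ^ n - 1 : ℤ_[p][X]) : PowerSeries ℤ_[p])} •
        (⊤ : Submodule (IwasawaAlgebra p) Y)))) :
    Nonempty (Y ≃ₗ[IwasawaAlgebra p] IwasawaAlgebra p) := by
  classical
  let φ : IwasawaAlgebra p →ₗ[IwasawaAlgebra p] Y := LinearMap.toSpanSingleton (IwasawaAlgebra p) Y x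
  have hφsurj : Function.Surjective φ := by
    rw [← LinearMap.range_eq_top, LinearMap.range_toSpanSingleton, hx]
  by_cases hk : LinearMap.ker φ = ⊥
  · exact ⟨(LinearEquiv.ofBijective φ ⟨LinearMap.ker_eq_bot.mp hk, hφsurj⟩).symm⟩
  · exfalso
    obtain ⟨f, hfk, hf0⟩ := (Submodule.ne_bot_iff _).mp hk
    have hfx : f • x = 0 := by simpa [φ] using hfk
    -- `rank Λ/(f) = B₀ < ℵ₀`
    obtain ⟨B₀, hB₀⟩ := Cardinal.lt_aleph0.mp (rank_quotient_span_lt_aleph0 p hf0)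
    obtain ⟨n, hn⟩ := hunb B₀
    -- `X ⧸ ω_n X` is a quotient of `Λ/(f)`
    set N : Submodule (IwasawaAlgebra p) Y :=
      Ideal.span {(((X + 1 : ℤ_[p][X]) ^ p ^ n - 1 : ℤ_[p][X]) : PowerSeries ℤ_[p])} • (⊤ : Submodule (IwasawaAlgebra p) Y)
      with hN
    let ψ₀ : IwasawaAlgebra p →ₗ[IwasawaAlgebra p] Y ⧸ N := N.mkQ ∘ₗ φ
    have hψ₀ : Ideal.span {f} ≤ LinearMap.ker ψ₀ := by
      intro z hz
      obtain ⟨c, rfl⟩ := Ideal.mem_span_singleton'.mp hz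
      rw [LinearMap.mem_ker, LinearMap.comp_apply, LinearMap.toSpanSingleton_apply, mul_smul, hfx, smul_zero, map_zero]
    let ψ : (IwasawaAlgebra p ⧸ Ideal.span {f}) →ₗ[IwasawaAlgebra p] Y ⧸ N := (Ideal.span {f}).liftQ ψ₀ hψ₀
    have hψsurj : Function.Surjective (ψ.restrictScalars ℤ_[p]) := by
      intro y
      obtain ⟨y', rfl⟩ := N.mkQ_surjective y
      obtain ⟨z, rfl⟩ := hφsurj y'
      exact ⟨Submodule.Quotient.mk z, rfl⟩
    have hle := LinearMap.rank_le_of_surjective _ hψsurj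
    rw [hB₀] at hle
    exact (lt_irrefl _) (hn.trans_le hle)

end Summit.BirchSwinnertonDyer.BirchSwinnertonDyer.Theorems.ResidualThetaLayer.CyclicLambda

end
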